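import Literature.AlgebraicGeometry.GroupSchemes.SubgroupSchemeOfSubgroupIdeal
import Mathlib.AlgebraicGeometry.Morphisms.Etale
import Mathlib.AlgebraicGeometry.Morphisms.Finite
import Mathlib.RingTheory.Etale.Pi
import Mathlib.RingTheory.Ideal.Quotient.Operations
import HarnessLib

/-!
# The constant scheme `Spec (R^I) → Spec R` on a finite set, its sections, and the constant group structure maps
# ([StacksProject] Tag 00EE idempotents and clopen points; [Tate1997FiniteFlatGroupSchemes] (3.7); [SerreTate1968] §1)

Topic `Literature/AlgebraicGeometry/GroupSchemes`; namespace `Literature.AlgebraicGeometry.GroupSchemes.ConstantGroupScheme`.  DEFINITIONS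
(`comul`, `evalPair`, `constOver`, `constSection`, `invLift`, `mulLift`) + their bookkeeping theorems; no instance, no notation, no named fact,
no `sorry`; universe-polymorphic (`R I : Type u`).  Cell `hodgecm-mathlib` (D-0151), FLOOR 0, P6 «MOD programme», sub-line
`Cruxes/HLiu418/Lines/F0_P6b_ConnectedEtale.lean` ED. 2, stub `stub_b4g_etaleClosureOfGenericSubgroup_henselian`, road σ1 «CLOPEN ∕
CONSTANT-SUBSCHEME currency» (F0P6-p13), file 1 of 2 (file 2 = `GroupSchemes/ConstantSubgroupOfSections`).  `--supports
stmt-HodgeConjecture-24832`; count-neutral: HC_CM is proved only modulo the printed citations until rung 0 closes, and nothing here bears on it.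

THE OBJECT.  For a commutative ring `R` and a finite set `I` the CONSTANT `R`-scheme `I_R := Spec (R^I) = ∐_I Spec R → Spec R`
(`constOver R I : Over (Spec R)`), with its `I` tautological sections `constSection R i` (`Spec` of the evaluation `R^I → R` at `i`);
for a finite group (indeed any `Mul`∕`Inv`) `I` the structure maps of the constant group scheme, `mulLift : I_R ×_R I_R → I_R` (`Spec` of the
comultiplication `comul : f ↦ Σ_{(i,j)} f(ij) · δ_i ⊗ δ_j`, through Mathlib `pullbackSpecIso`) and `invLift` (`Spec` of `f ↦ f ∘ (·)⁻¹`),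
computed on sections: `(σ_i, σ_j) ≫ mulLift = σ_{ij}`, `σ_i ≫ invLift = σ_{i⁻¹}`.  The group-object axioms are NOT imposed here (file 2 obtains
the `GrpObj` structure for free from ★ `GroupSchemes.exists_grpObj_isMonHom_of_lifts` once `I_R` is embedded in a group scheme).

THE TOOLS.  §1 the algebra of `R^I`: the indicator idempotents `δ_i = Pi.single i 1` (orthogonal, complete), `comul`, the evaluations
`evalPair i j : R^I ⊗_R R^I → R` (`f ⊗ g ↦ f(i) g(j)`) with kernel `(1 - δ_i ⊗ δ_j)` and `evalPair i j ∘ comul = ev_{ij}`.  §2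
**`hom_ext_of_clopen_points`**: morphisms `Spec A → Y` agreeing on a family of CLOPEN `Spec`-points `Spec (A⧸(1-e_k)) ↪ Spec A`
(`e_k` idempotents not all contained in any prime) are equal (Mathlib `isOpenImmersion_SpecMap_iff_of_surjective`, `Scheme.Cover.hom_ext`),
whence `hom_ext_constOver` (morphisms out of `I_R` are determined on the sections) and `hom_ext_constOver_tensor` (out of `I_R ×_R I_R`, on
pairs of sections).  §3 over a LOCAL ring every section of `I_R` is tautological (`exists_eq_constSection`: an `R`-algebra retraction `R^I → R`
is an evaluation, the images of the `δ_i` being complementary idempotents of the local ring `R`); `I_R → Spec R` is FINITE and ÉTALE (Mathlib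
`IsFinite.SpecMap_iff`, `HasRingHomProperty.Spec_iff`, `Algebra.Etale R (I → R)`).  §4 `invLift`, `mulLift` and their values on sections.

## References
* [StacksProject] The Stacks Project, Tag 00EE (Algebra, Lemma 10.21.3: idempotents and open-and-closed subsets of `Spec`), Tag 00DT
  (Lemma 10.15.4, Chinese remainder), Tag 04GG.
* [Tate1997FiniteFlatGroupSchemes] J. Tate, *Finite flat group schemes*, in: Cornell–Silverman–Stevens (eds.), *Modular Forms and Fermat's Last
  Theorem* (Springer 1997), (3.7) (constant and étale finite group schemes over a henselian local ring).
* [SerreTate1968] J.-P. Serre, J. Tate, *Good reduction of abelian varieties*, Ann. of Math. 88 (1968), §1.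
-/

noncomputable section

set_option backward.isDefEq.respectTransparency false

universe u

open CategoryTheory CategoryTheory.Limits AlgebraicGeometry MonoidalCategory CartesianMonoidalCategory TensorProduct
open scoped MonObj

namespace Literature.AlgebraicGeometry.GroupSchemes.ConstantGroupScheme

/-! ## §1 Algebra of the ring `R^I` of functions on a finite set ∕ magma `I` -/

section Algebra

variable (R : Type u) [CommRing R] (I : Type u) [Fintype I] [DecidableEq I]

omit [Fintype I] in
/-- The indicator functions `δ_i = Pi.single i 1 ∈ R^I` are orthogonal idempotents: `δ_i δ_j = [i = j] δ_i`. [cite: StacksProject, Tag 00EE] -/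
theorem single_mul_single (i j : I) :
    (Pi.single i 1 : I → R) * Pi.single j 1 = if i = j then Pi.single i 1 else 0 := by
  ext k
  rw [Pi.mul_apply]
  by_cases hki : k = i
  · subst hki
    by_cases hkj : k = j
    · subst hkj; simp
    · rw [if_neg hkj, Pi.single_eq_same, one_mul, Pi.single_eq_of_ne hkj, Pi.zero_apply]
  · rw [Pi.single_eq_of_ne hki, zero_mul]
    split_ifs
    · rw [Pi.single_eq_of_ne hki]
    · rfl

/-- The indicator idempotents of `R^I` sum to `1`. [cite: StacksProject, Tag 00EE] -/
theorem sum_single : ∑ i : I, (Pi.single i 1 : I → R) = 1 := by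
  ext k
  simp [Finset.sum_apply, Pi.single_apply]

omit [Fintype I] in
/-- `f · δ_i = f(i) δ_i` in `R^I`. [cite: StacksProject, Tag 00EE] -/
theorem mul_single_eq_smul (f : I → R) (i : I) : f * Pi.single i 1 = f i • (Pi.single i 1 : I → R) := by
  ext k
  by_cases hk : k = i
  · subst hk; simp
  · simp [hk]

/-- `f = Σ_i f(i) δ_i` in `R^I`. [cite: StacksProject, Tag 00EE] -/
theorem eq_sum_smul_single (f : I → R) : f = ∑ i, f i • (Pi.single i 1 : I → R) := by
  ext k
  simp [Finset.sum_apply, Pi.single_apply]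

/-- **The comultiplication of the constant group scheme**: the `R`-algebra map `R^I → R^I ⊗_R R^I`, `f ↦ Σ_{(i,j)} f(i j) · δ_i ⊗ δ_j`
(for any finite `I` with a multiplication; it is dual to `I × I → I`).  Multiplicativity comes from the orthogonality of the `δ_i ⊗ δ_j`.
[cite: Tate1997FiniteFlatGroupSchemes, (3.7)] [cite: StacksProject, Tag 00EE] -/
def comul [Mul I] : (I → R) →ₐ[R] (I → R) ⊗[R] (I → R) where
  toFun f := ∑ p : I × I, f (p.1 * p.2) • ((Pi.single p.1 1 : I → R) ⊗ₜ[R] (Pi.single p.2 1 : I → R))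
  map_one' := by
    simp only [Pi.one_apply, one_smul]
    rw [← Finset.univ_product_univ, Finset.sum_product, Algebra.TensorProduct.one_def, ← sum_single R I,
      TensorProduct.sum_tmul]
    refine Finset.sum_congr rfl fun i _ => ?_
    rw [TensorProduct.tmul_sum]
  map_mul' f g := by
    rw [Finset.sum_mul_sum]
    refine Finset.sum_congr rfl fun p _ => ?_
    rw [Finset.sum_eq_single p]
    · rw [smul_mul_smul_comm, Algebra.TensorProduct.tmul_mul_tmul, single_mul_single, single_mul_single, if_pos rfl,
        if_pos rfl, Pi.mul_apply]
    · intro q _ hq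
      rw [smul_mul_smul_comm, Algebra.TensorProduct.tmul_mul_tmul, single_mul_single, single_mul_single]
      by_cases h1 : p.1 = q.1
      · have h2 : p.2 ≠ q.2 := fun h2 => hq (Prod.ext h1.symm h2.symm)
        rw [if_neg h2, TensorProduct.tmul_zero, smul_zero]
      · rw [if_neg h1, TensorProduct.zero_tmul, smul_zero]
    · intro h; exact absurd (Finset.mem_univ p) h
  map_zero' := by simp
  map_add' f g := by
    simp only [Pi.add_apply, add_smul, Finset.sum_add_distrib]
  commutes' r := by
    simp only [Pi.algebraMap_apply, Algebra.algebraMap_self_apply]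
    rw [Algebra.TensorProduct.algebraMap_apply, Algebra.algebraMap_eq_smul_one, ← sum_single R I,
      Finset.smul_sum, TensorProduct.sum_tmul, ← Finset.univ_product_univ, Finset.sum_product]
    refine Finset.sum_congr rfl fun i _ => ?_
    rw [← TensorProduct.smul_tmul', TensorProduct.tmul_sum, Finset.smul_sum]

/-- The formula for `comul`. [cite: Tate1997FiniteFlatGroupSchemes, (3.7)] -/
theorem comul_apply [Mul I] (f : I → R) :
    comul R I f = ∑ p : I × I, f (p.1 * p.2) • ((Pi.single p.1 1 : I → R) ⊗ₜ[R] (Pi.single p.2 1 : I → R)) := rfl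

/-- **The point `(i, j)` of `R^I ⊗_R R^I`**: the `R`-algebra map `f ⊗ g ↦ f(i) g(j)` (Mathlib `Algebra.TensorProduct.lift` of the two evaluations).
[cite: StacksProject, Tag 00EE] -/
def evalPair (i j : I) : (I → R) ⊗[R] (I → R) →ₐ[R] R :=
  Algebra.TensorProduct.lift (Pi.evalAlgHom R (fun _ => R) i) (Pi.evalAlgHom R (fun _ => R) j) fun _ _ => Commute.all _ _

omit [Fintype I] [DecidableEq I] in
/-- `evalPair i j (f ⊗ g) = f(i) g(j)`. [cite: StacksProject, Tag 00EE] -/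
theorem evalPair_tmul (i j : I) (f g : I → R) : evalPair R I i j (f ⊗ₜ g) = f i * g j :=
  Algebra.TensorProduct.lift_tmul _ _ _ f g

/-- **`evalPair i j ∘ comul = ev_{i j}`**: on points the comultiplication is the multiplication of `I`. [cite: Tate1997FiniteFlatGroupSchemes, (3.7)] -/
theorem evalPair_comul [Mul I] (i j : I) (f : I → R) : evalPair R I i j (comul R I f) = f (i * j) := by
  rw [comul_apply, map_sum, Finset.sum_eq_single (i, j)]
  · rw [map_smul, evalPair_tmul, smul_eq_mul]; simp
  · rintro ⟨a, b⟩ - hq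
    rw [map_smul, evalPair_tmul, smul_eq_mul]
    by_cases ha : a = i
    · subst ha
      have hb : b ≠ j := fun hb => hq (by rw [hb])
      simp [Ne.symm hb]
    · simp [Ne.symm ha]
  · intro h; exact absurd (Finset.mem_univ _) h

omit [Fintype I] in
/-- `x · (δ_i ⊗ δ_j) = evalPair i j (x) · (δ_i ⊗ δ_j)` for every `x ∈ R^I ⊗ R^I` (checked on pure tensors). [cite: StacksProject, Tag 00EE] -/
theorem mul_single_tmul_single (x : (I → R) ⊗[R] (I → R)) (i j : I) :
    x * (Pi.single i 1 ⊗ₜ Pi.single j 1) =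
      evalPair R I i j x • ((Pi.single i 1 : I → R) ⊗ₜ[R] (Pi.single j 1 : I → R)) := by
  induction x using TensorProduct.induction_on with
  | zero => rw [zero_mul, map_zero, zero_smul]
  | tmul f g =>
    rw [Algebra.TensorProduct.tmul_mul_tmul, mul_single_eq_smul, mul_single_eq_smul, evalPair_tmul,
      TensorProduct.smul_tmul_smul]
  | add x y hx hy => rw [add_mul, hx, hy, map_add, add_smul]

omit [Fintype I] in
/-- **The kernel of the point `(i, j)` is generated by the idempotent `1 - δ_i ⊗ δ_j`** (so `Spec R → Spec (R^I ⊗ R^I)` at `(i,j)` is an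
open immersion, Mathlib `isOpenImmersion_SpecMap_iff_of_surjective`). [cite: StacksProject, Tag 00EE] -/
theorem ker_evalPair (i j : I) :
    RingHom.ker (evalPair R I i j) = Ideal.span {1 - (Pi.single i 1 : I → R) ⊗ₜ[R] (Pi.single j 1 : I → R)} := by
  apply le_antisymm
  · intro x hx
    rw [RingHom.mem_ker] at hx
    have h := mul_single_tmul_single R I x i j
    rw [hx, zero_smul] at h
    have e : x = x * (1 - Pi.single i 1 ⊗ₜ[R] Pi.single j 1) := by rw [mul_sub, mul_one, h, sub_zero]
    rw [e]
    exact Ideal.mul_mem_left _ _ (Ideal.subset_span rfl)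
  · rw [Ideal.span_le, Set.singleton_subset_iff, SetLike.mem_coe, RingHom.mem_ker, map_sub, map_one, evalPair_tmul]
    simp

omit [Fintype I] in
/-- `δ_i ⊗ δ_j` is idempotent. [cite: StacksProject, Tag 00EE] -/
theorem isIdempotentElem_single_tmul_single (i j : I) :
    IsIdempotentElem ((Pi.single i 1 : I → R) ⊗ₜ[R] (Pi.single j 1 : I → R)) := by
  rw [IsIdempotentElem, Algebra.TensorProduct.tmul_mul_tmul, single_mul_single, single_mul_single, if_pos rfl,
    if_pos rfl]

omit [Fintype I] [DecidableEq I] in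
/-- `evalPair i j` is surjective (it is a retraction of the structure map). [cite: StacksProject, Tag 00EE] -/
theorem evalPair_surjective (i j : I) : Function.Surjective (evalPair R I i j) :=
  fun r => ⟨algebraMap R _ r, AlgHom.commutes _ r⟩

/-- Every proper ideal of `R^I ⊗_R R^I` misses some `δ_i ⊗ δ_j` (they sum to `1`): the clopen points `(i, j)` COVER `Spec (R^I ⊗ R^I)`.
[cite: StacksProject, Tag 00EE] -/
theorem exists_single_tmul_single_not_mem (𝔭 : Ideal ((I → R) ⊗[R] (I → R))) (h𝔭 : 𝔭 ≠ ⊤) :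
    ∃ p : I × I, (Pi.single p.1 1 : I → R) ⊗ₜ[R] (Pi.single p.2 1 : I → R) ∉ 𝔭 := by
  by_contra h
  simp only [not_exists, not_not] at h
  apply h𝔭
  rw [Ideal.eq_top_iff_one, Algebra.TensorProduct.one_def, ← sum_single R I, TensorProduct.sum_tmul]
  refine Ideal.sum_mem _ fun i _ => ?_
  rw [TensorProduct.tmul_sum]
  exact Ideal.sum_mem _ fun j _ => h (i, j)

end Algebra

/-! ## §2 The constant `R`-scheme `Spec (R^I)`, its sections, and clopen-point covers -/

section Constant

variable (R : Type u) [CommRing R]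

/-- **Morphisms out of `Spec A` are determined on a covering family of clopen `Spec`-points.**  Let `q_k : A ↠ B_k` be surjections whose
kernels are generated by idempotents `1 - e_k` such that no prime contains every `e_k`.  Then the `Spec (q_k) : Spec B_k → Spec A` are open
immersions (Mathlib `isOpenImmersion_SpecMap_iff_of_surjective`) covering `Spec A` (a prime missing `e_k` contains `1 - e_k`), and two
morphisms `Spec A → Y` agreeing after each `Spec (q_k)` are equal (Mathlib `Scheme.Cover.hom_ext`). [cite: StacksProject, Tag 00EE] -/
theorem hom_ext_of_clopen_points {A : CommRingCat.{u}} {K : Type*} (B : K → CommRingCat.{u}) (q : ∀ k, A ⟶ B k)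
    (hq : ∀ k, Function.Surjective (q k).hom) (e : K → A) (he : ∀ k, IsIdempotentElem (e k))
    (hker : ∀ k, RingHom.ker (q k).hom = Ideal.span {1 - e k})
    (hcov : ∀ 𝔭 : PrimeSpectrum A, ∃ k, e k ∉ 𝔭.asIdeal) {Y : Scheme.{u}} (f g : Spec A ⟶ Y)
    (h : ∀ k, Spec.map (q k) ≫ f = Spec.map (q k) ≫ g) : f = g := by
  let 𝒰 : (Spec A).OpenCover := Scheme.Cover.mkOfCovers K (fun k => Spec (B k)) (fun k => Spec.map (q k))
    (fun x => by
      obtain ⟨k, hk⟩ := hcov x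
      have hx : x ∈ Set.range (PrimeSpectrum.comap (q k).hom) := by
        rw [range_comap_of_surjective _ _ (hq k), hker k, PrimeSpectrum.mem_zeroLocus]
        have h0 : e k * (1 - e k) ∈ x.asIdeal := by rw [(he k).mul_one_sub_self]; exact x.asIdeal.zero_mem
        exact SetLike.coe_subset_coe.mpr
          (Ideal.span_le.mpr (Set.singleton_subset_iff.mpr ((x.2.mem_or_mem h0).resolve_left hk)))
      obtain ⟨y, hy⟩ := hx
      exact ⟨k, y, hy⟩)
    (fun k => (isOpenImmersion_SpecMap_iff_of_surjective _ (hq k)).mpr ⟨1 - e k, (he k).one_sub, hker k⟩)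
  exact Scheme.Cover.hom_ext 𝒰 f g h

variable (I : Type u)

/-- **The constant `R`-scheme on the finite set `I`**: `I_R := Spec (R^I) → Spec R` as an object of `Over (Spec R)` (`≅ ∐_I Spec R`; for a
finite group `I` the underlying scheme of the constant group scheme). [cite: Tate1997FiniteFlatGroupSchemes, (3.7)] -/
def constOver : Over (Spec (.of R)) :=
  Over.mk (Spec.map (CommRingCat.ofHom (algebraMap R (I → R))))

variable {I}

/-- **The tautological section of `I_R` at `i ∈ I`**: `Spec` of the evaluation `R^I → R` at `i`, a morphism `𝟙_ ⟶ I_R` over `Spec R`.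
[cite: Tate1997FiniteFlatGroupSchemes, (3.7)] -/
def constSection (i : I) : 𝟙_ (Over (Spec (.of R))) ⟶ constOver R I :=
  Over.homMk (Spec.map (CommRingCat.ofHom (Pi.evalRingHom (fun _ : I => R) i))) (by
    change Spec.map _ ≫ Spec.map _ = 𝟙 _
    rw [← Spec.map_comp, ← CommRingCat.ofHom_comp]
    have : (Pi.evalRingHom (fun _ : I => R) i).comp (algebraMap R (I → R)) = RingHom.id R := RingHom.ext fun r => rfl
    rw [this, CommRingCat.ofHom_id, Spec.map_id])

/-- The underlying morphism of the tautological section at `i` is `Spec (ev_i)`. [cite: Tate1997FiniteFlatGroupSchemes, (3.7)] -/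
@[simp]
theorem constSection_left (i : I) :
    (constSection R i).left = Spec.map (CommRingCat.ofHom (Pi.evalRingHom (fun _ : I => R) i)) := rfl

/-- Distinct points of `I` give distinct sections of `I_R` (`R ≠ 0`). [cite: Tate1997FiniteFlatGroupSchemes, (3.7)] -/
theorem constSection_injective [Nontrivial R] : Function.Injective (constSection R (I := I)) := by
  classical
  intro i j h
  have h1 : (constSection R i).left = (constSection R j).left := by rw [h]
  rw [constSection_left, constSection_left] at h1
  have h2 := congrArg (fun f => (Spec.preimage f)) h1
  simp only [Spec.preimage_map] at h2
  have h3 := congrArg (fun f : CommRingCat.of (I → R) ⟶ CommRingCat.of R => f.hom (Pi.single i 1)) h2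
  simp only [CommRingCat.hom_ofHom, Pi.evalRingHom_apply, Pi.single_eq_same] at h3
  by_contra hij
  rw [Pi.single_eq_of_ne (Ne.symm hij)] at h3
  exact one_ne_zero h3

variable [Fintype I] [DecidableEq I]

/-- **Morphisms out of `I_R = Spec (R^I)` are determined by their restrictions to the tautological sections** (the sections are the clopen
points `D(δ_i)`, which cover). [cite: StacksProject, Tag 00EE] -/
theorem hom_ext_constOver {Y : Scheme.{u}} (f g : (constOver R I).left ⟶ Y)
    (h : ∀ i, (constSection R i).left ≫ f = (constSection R i).left ≫ g) : f = g :=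
  hom_ext_of_clopen_points (A := CommRingCat.of (I → R)) (fun _ => CommRingCat.of R)
    (fun i => CommRingCat.ofHom (Pi.evalRingHom (fun _ : I => R) i))
    (fun i => Function.RightInverse.surjective (g := algebraMap R (I → R)) fun r => rfl)
    (fun i => Pi.single i 1) (fun i => by rw [IsIdempotentElem, single_mul_single, if_pos rfl])
    (fun i => by
      apply le_antisymm
      · intro x hx
        rw [RingHom.mem_ker, CommRingCat.hom_ofHom, Pi.evalRingHom_apply] at hx
        have e : x = x * (1 - Pi.single i 1) := by
          rw [mul_sub, mul_one, mul_single_eq_smul, hx, zero_smul, sub_zero]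
        rw [e]
        exact Ideal.mul_mem_left _ _ (Ideal.subset_span rfl)
      · rw [Ideal.span_le, Set.singleton_subset_iff, SetLike.mem_coe, RingHom.mem_ker]
        show Pi.evalRingHom (fun _ : I => R) i (1 - Pi.single i 1) = 0
        rw [map_sub, map_one, Pi.evalRingHom_apply, Pi.single_eq_same, sub_self])
    (fun 𝔭 => by
      by_contra hc
      simp only [not_exists, not_not] at hc
      exact 𝔭.2.ne_top ((Ideal.eq_top_iff_one _).mpr (by rw [← sum_single R I]; exact Ideal.sum_mem _ fun i _ => hc i)))
    f g h

omit [Fintype I] [DecidableEq I] in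
/-- Under Mathlib's `pullbackSpecIso : I_R ×_R I_R ≅ Spec (R^I ⊗_R R^I)` the pair of sections `(σ_i, σ_j)` is the point `evalPair i j`.
[cite: StacksProject, Tag 00EE] -/
theorem lift_constSection_left_comp_pullbackSpecIso_hom (i j : I) :
    (CartesianMonoidalCategory.lift (constSection R i) (constSection R j)).left ≫
        (pullbackSpecIso R (I → R) (I → R)).hom =
      Spec.map (CommRingCat.ofHom (evalPair R I i j).toRingHom) := by
  rw [← cancel_mono (pullbackSpecIso R (I → R) (I → R)).inv, Category.assoc, Iso.hom_inv_id, Category.comp_id]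
  apply pullback.hom_ext
  · erw [Category.assoc, pullbackSpecIso_inv_fst, ← Spec.map_comp, ← Over.fst_left,
      ← Over.comp_left, CartesianMonoidalCategory.lift_fst, constSection_left]
    congr 1
    apply CommRingCat.hom_ext
    apply RingHom.ext
    intro f
    change f i = evalPair R I i j (f ⊗ₜ 1)
    rw [evalPair_tmul, Pi.one_apply, mul_one]
  · erw [Category.assoc, pullbackSpecIso_inv_snd, ← Spec.map_comp, ← Over.snd_left,
      ← Over.comp_left, CartesianMonoidalCategory.lift_snd, constSection_left]
    congr 1
    apply CommRingCat.hom_ext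
    apply RingHom.ext
    intro f
    change f j = evalPair R I i j (1 ⊗ₜ f)
    rw [evalPair_tmul, Pi.one_apply, one_mul]

/-- **Morphisms out of `I_R ×_R I_R` are determined by their restrictions to the pairs of tautological sections** (the `|I|²` clopen points
`(i, j)` cover `Spec (R^I ⊗_R R^I)`). [cite: StacksProject, Tag 00EE] -/
theorem hom_ext_constOver_tensor {Y : Scheme.{u}} (f g : (constOver R I ⊗ constOver R I).left ⟶ Y)
    (h : ∀ i j, (CartesianMonoidalCategory.lift (constSection R i) (constSection R j)).left ≫ f =
      (CartesianMonoidalCategory.lift (constSection R i) (constSection R j)).left ≫ g) : f = g := by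
  rw [← cancel_epi (pullbackSpecIso R (I → R) (I → R)).inv]
  refine hom_ext_of_clopen_points (A := CommRingCat.of ((I → R) ⊗[R] (I → R))) (K := I × I) (fun _ => CommRingCat.of R)
    (fun p => CommRingCat.ofHom (evalPair R I p.1 p.2).toRingHom) (fun p => evalPair_surjective R I p.1 p.2)
    (fun p => Pi.single p.1 1 ⊗ₜ Pi.single p.2 1) (fun p => isIdempotentElem_single_tmul_single R I p.1 p.2)
    (fun p => ker_evalPair R I p.1 p.2) (fun 𝔭 => exists_single_tmul_single_not_mem R I 𝔭.asIdeal 𝔭.2.ne_top) _ _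
    fun p => ?_
  rw [← lift_constSection_left_comp_pullbackSpecIso_hom, Category.assoc, Category.assoc, Iso.hom_inv_id_assoc,
    Iso.hom_inv_id_assoc]
  exact h p.1 p.2

end Constant

/-! ## §3 Sections of the constant scheme over a local ring; finiteness and étaleness -/

section Sections

variable (R : Type u) [CommRing R] {I : Type u} [Fintype I] [DecidableEq I]

omit [Fintype I] [DecidableEq I] in
/-- The structure morphism of `I_R` is `Spec (R → R^I)`. [cite: Tate1997FiniteFlatGroupSchemes, (3.7)] -/
@[simp]
theorem constOver_hom : (constOver R I).hom = Spec.map (CommRingCat.ofHom (algebraMap R (I → R))) := rfl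

omit [Fintype I] [DecidableEq I] in
/-- An idempotent of a local ring is `0` or `1` (one of `e`, `1 - e` is a unit). [cite: StacksProject, Tag 00EE] -/
theorem eq_zero_or_one_of_isIdempotentElem [IsLocalRing R] {x : R} (hx : IsIdempotentElem x) : x = 0 ∨ x = 1 := by
  rcases IsLocalRing.isUnit_or_isUnit_one_sub_self x with h | h
  · right
    have e : x * x = x * 1 := by rw [mul_one]; exact hx
    exact h.mul_left_cancel e
  · left
    have h1 : IsIdempotentElem (1 - x) := hx.one_sub
    have e : (1 - x) * (1 - x) = (1 - x) * 1 := by rw [mul_one]; exact h1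
    have := h.mul_left_cancel e
    rwa [sub_eq_self] at this

/-- **An `R`-algebra retraction `χ : R^I → R` into a LOCAL ring is the evaluation at a point**: the `χ(δ_i)` are complementary orthogonal
idempotents of `R`, so exactly one of them is `1`. [cite: StacksProject, Tag 00EE] [cite: Tate1997FiniteFlatGroupSchemes, (3.7)] -/
theorem exists_eq_evalRingHom [IsLocalRing R] (χ : (I → R) →+* R) (hχ : ∀ r, χ (algebraMap R (I → R) r) = r) :
    ∃ i, χ = Pi.evalRingHom (fun _ : I => R) i := by
  have hidem : ∀ i, IsIdempotentElem (χ (Pi.single i 1)) := fun i => by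
    rw [IsIdempotentElem, ← map_mul, single_mul_single, if_pos rfl]
  have hsum : ∑ i, χ (Pi.single i 1) = 1 := by rw [← map_sum, sum_single, map_one]
  obtain ⟨i₀, hi₀⟩ : ∃ i, χ (Pi.single i 1) = 1 := by
    by_contra h
    simp only [not_exists] at h
    have h0 : ∑ i, χ (Pi.single i 1) = 0 :=
      Finset.sum_eq_zero fun i _ => (eq_zero_or_one_of_isIdempotentElem R (hidem i)).resolve_right (h i)
    rw [hsum] at h0
    exact one_ne_zero h0
  have hother : ∀ i, i ≠ i₀ → χ (Pi.single i 1) = 0 := fun i hi => by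
    have e := congrArg χ (single_mul_single R I i i₀)
    rwa [if_neg hi, map_mul, hi₀, mul_one, map_zero] at e
  refine ⟨i₀, RingHom.ext fun f => ?_⟩
  rw [Pi.evalRingHom_apply]
  conv_lhs => rw [eq_sum_smul_single R I f]
  rw [map_sum, Finset.sum_eq_single i₀]
  · rw [Algebra.smul_def, map_mul, hχ, hi₀, mul_one]
  · intro i _ hi
    rw [Algebra.smul_def, map_mul, hother i hi, mul_zero]
  · intro h; exact absurd (Finset.mem_univ _) h

/-- **Over a LOCAL ring every section of the constant scheme `I_R` is tautological** (`Spec R` is connected): a section is `Spec` of an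
`R`-algebra retraction `R^I → R` (Mathlib `Spec.preimage`), i.e. of an evaluation. [cite: Tate1997FiniteFlatGroupSchemes, (3.7)] -/
theorem exists_eq_constSection [IsLocalRing R] (sbar : 𝟙_ (Over (Spec (.of R))) ⟶ constOver R I) :
    ∃ i, sbar = constSection R i := by
  let χ : CommRingCat.of (I → R) ⟶ CommRingCat.of R := Spec.preimage sbar.left
  have h1 : Spec.map χ = sbar.left := Spec.map_preimage _
  have h2 : CommRingCat.ofHom (algebraMap R (I → R)) ≫ χ = 𝟙 _ := by
    apply Spec.map_injective
    rw [Spec.map_comp, Spec.map_id, h1]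
    exact Over.w sbar
  obtain ⟨i, hi⟩ := exists_eq_evalRingHom R χ.hom fun r => by
    change (CommRingCat.ofHom (algebraMap R (I → R)) ≫ χ).hom r = r
    rw [h2]; rfl
  refine ⟨i, Over.OverMorphism.ext ?_⟩
  rw [← h1, constSection_left, ← hi, CommRingCat.ofHom_hom]

omit [DecidableEq I] in
/-- `I_R → Spec R` is finite (`R^I` is a finite `R`-module). [cite: Tate1997FiniteFlatGroupSchemes, (3.7)] -/
theorem isFinite_constOver_hom : IsFinite (constOver R I).hom := by
  rw [constOver_hom, IsFinite.SpecMap_iff, CommRingCat.hom_ofHom, RingHom.finite_algebraMap]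
  infer_instance

omit [DecidableEq I] in
/-- `I_R → Spec R` is étale (`R^I` is a finite product of copies of `R`, Mathlib `Algebra.Etale R (I → R)`). [cite: Tate1997FiniteFlatGroupSchemes, (3.7)] -/
theorem etale_constOver_hom : Etale (constOver R I).hom := by
  rw [constOver_hom, HasRingHomProperty.Spec_iff (P := @Etale), CommRingCat.hom_ofHom, RingHom.etale_algebraMap]
  infer_instance

end Sections

/-! ## §4 The constant group structure maps `invLift`, `mulLift` and their values on sections -/

section GroupMaps

variable (R : Type u) [CommRing R] (I : Type u)

section Inv

variable [Inv I]

/-- **The inversion of the constant scheme on `I`** (any `Inv I`): `Spec` of `R^I → R^I`, `f ↦ (i ↦ f(i⁻¹))`, over `Spec R`.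
[cite: Tate1997FiniteFlatGroupSchemes, (3.7)] -/
def invLift : constOver R I ⟶ constOver R I :=
  Over.homMk (Spec.map (CommRingCat.ofHom (RingHom.pi fun i : I => Pi.evalRingHom (fun _ : I => R) i⁻¹))) (by
    change Spec.map _ ≫ Spec.map _ = Spec.map _
    rw [← Spec.map_comp, ← CommRingCat.ofHom_comp]
    rfl)

/-- On sections the inversion is `σ_i ↦ σ_{i⁻¹}`. [cite: Tate1997FiniteFlatGroupSchemes, (3.7)] -/
theorem constSection_comp_invLift (s : I) : constSection R s ≫ invLift R I = constSection R s⁻¹ := by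
  apply Over.OverMorphism.ext
  rw [Over.comp_left, constSection_left, constSection_left]
  change Spec.map _ ≫ Spec.map _ = _
  rw [← Spec.map_comp, ← CommRingCat.ofHom_comp]
  rfl

end Inv

section MulMaps

variable [Fintype I] [DecidableEq I] [Mul I]


/-- **The multiplication of the constant scheme on `I`** (finite `I` with `Mul`): `I_R ×_R I_R ≅ Spec (R^I ⊗_R R^I) → Spec (R^I) = I_R`, the
first map Mathlib's `pullbackSpecIso`, the second `Spec` of the comultiplication `comul`; a morphism over `Spec R`.
[cite: Tate1997FiniteFlatGroupSchemes, (3.7)] -/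
def mulLift : constOver R I ⊗ constOver R I ⟶ constOver R I :=
  Over.homMk ((pullbackSpecIso R (I → R) (I → R)).hom ≫ Spec.map (CommRingCat.ofHom (comul R I).toRingHom)) (by
    change ((pullbackSpecIso R (I → R) (I → R)).hom ≫ Spec.map (CommRingCat.ofHom (comul R I).toRingHom)) ≫
        Spec.map (CommRingCat.ofHom (algebraMap R (I → R))) =
      pullback.fst _ _ ≫ Spec.map (CommRingCat.ofHom (algebraMap R (I → R)))
    rw [Category.assoc, ← Spec.map_comp, ← CommRingCat.ofHom_comp, AlgHom.toRingHom_eq_coe, AlgHom.comp_algebraMap,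
      ← pullbackSpecIso_hom_fst R (I → R) (I → R), Category.assoc, ← Spec.map_comp, ← CommRingCat.ofHom_comp]
    rfl)

/-- The underlying morphism of `mulLift`. [cite: Tate1997FiniteFlatGroupSchemes, (3.7)] -/
theorem mulLift_left : (mulLift R I).left =
    (pullbackSpecIso R (I → R) (I → R)).hom ≫ Spec.map (CommRingCat.ofHom (comul R I).toRingHom) := rfl

/-- **On sections the multiplication is `(σ_s, σ_t) ↦ σ_{st}`** (`evalPair s t ∘ comul = ev_{st}`). [cite: Tate1997FiniteFlatGroupSchemes, (3.7)] -/
theorem lift_constSection_comp_mulLift (s t : I) :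
    CartesianMonoidalCategory.lift (constSection R s) (constSection R t) ≫ mulLift R I = constSection R (s * t) := by
  apply Over.OverMorphism.ext
  rw [Over.comp_left, mulLift_left, ← Category.assoc, lift_constSection_left_comp_pullbackSpecIso_hom, ← Spec.map_comp,
    constSection_left]
  congr 1
  apply CommRingCat.hom_ext
  apply RingHom.ext
  intro f
  exact evalPair_comul R I s t f

end MulMaps

end GroupMaps

end Literature.AlgebraicGeometry.GroupSchemes.ConstantGroupScheme

end
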